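import Summits.NavierStokesRegularity.NavierStokesRegularity.Theorems.ExtremiserTransienceNearExtremalTransienceExtremiserLiouvilleConstantSpeedAxialCutoff
import HarnessLib

/-!
# Crux `ExtremiserTransience.NearExtremalTransience` (stmt-NavierStokesRegularity-21883), line `extremiser_liouville`,
# stub K1b — the RADIAL ANNULAR cut-off `θ_{R,R′} = (1 − χ_R)·χ_{R′}` and its derivative weights

`--supports stmt-NavierStokesRegularity-21883` (helper).  Author: prover seat `ns-el-k1b` (g7).  The weight for the radial TAIL
LAW (`…ConstantSpeedTailLaw`): with the tree's radial cut-off `χ_ρ = cutoff ρ` (`= 1` on `B̄_ρ`, `= 0` off `B_{2ρ}`) the annular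
cut-off `θ(x) = (1 − χ_R(x))·χ_{R′}(x)` (`1 ≤ R`, `4R ≤ R′`) vanishes on `B_R`, equals `1` on `{2R ≤ ‖x‖ ≤ R′}` and vanishes off
`B_{2R′}`; its first two derivatives are supported in the two transition annuli with the natural sizes:

* `iteratedFDeriv_cutoff_eq_zero_of_lt` (`‖x‖ < ρ`, order `≥ 1`), `iteratedFDeriv_cutoff_eq_zero_of_gt` (`2ρ < ‖x‖`, every order);
* `radialCutoff_eq_one`, `radialCutoff_eq_zero_of_lt`, `tsupport_radialCutoff_subset` (`⊆ {R ≤ ‖x‖}`), smoothness, `[0,1]`-values;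
* `exists_radialCutoff_weights` — ONE constant `K` with, for all `1 ≤ R`, `4R ≤ R′`, all `x`:
  `‖Dθ(x)‖ ≤ (K/R)·𝟙_{‖x‖≤2R} + (K/R′)·𝟙_{R′≤‖x‖}` and `‖D∇θ(x)‖ ≤ (K/R²)·𝟙_{‖x‖≤2R} + (K/R′²)·𝟙_{R′≤‖x‖}`.

WHAT THIS IS NOT: K1b is NOT proved; nothing here proves NS regularity. [folklore]
-/

noncomputable section

open Set Filter Topology MeasureTheory Metric Function Real
open scoped ENNReal NNReal Topology InnerProductSpace RealInnerProductSpace ContDiff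

namespace Summit.NavierStokesRegularity.NavierStokesRegularity.Theorems

-- the problem directory repeats the summit name (`NavierStokesRegularity/NavierStokesRegularity`)
set_option linter.dupNamespace false

namespace ExtremiserLiouville

open Literature.Analysis.FluidPDE
open DepletionLadder.KStar DepletionLadder.KStar.HalfSpace

/-! ## 1. Where the radial cut-off is locally constant -/

/-- Inside `B_ρ` every derivative of order `n ≥ 1` of `χ_ρ` vanishes (`χ_ρ = 1` near `x`). [folklore] -/
theorem iteratedFDeriv_cutoff_eq_zero_of_lt {ρ : ℝ} (hρ : 0 < ρ) {x : E3} (hx : ‖x‖ < ρ) {n : ℕ} (hn : n ≠ 0) :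
    iteratedFDeriv ℝ n (cutoff (E := E3) ρ) x = 0 := by
  have hev : (cutoff (E := E3) ρ) =ᶠ[𝓝 x] fun _ => (1 : ℝ) := by
    have hopen : IsOpen (ball (0 : E3) ρ) := isOpen_ball
    filter_upwards [hopen.mem_nhds (mem_ball_zero_iff.2 hx)] with y hy
    exact cutoff_eq_one hρ (mem_ball_zero_iff.1 hy).le
  rw [(hev.iteratedFDeriv ℝ n).eq_of_nhds, iteratedFDeriv_const_of_ne hn]
  rfl

/-- Off `B̄_{2ρ}` every derivative of `χ_ρ` vanishes (`x ∉ tsupport χ_ρ`). [folklore] -/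
theorem iteratedFDeriv_cutoff_eq_zero_of_gt {ρ : ℝ} (hρ : 0 < ρ) {x : E3} (hx : 2 * ρ < ‖x‖) (n : ℕ) :
    iteratedFDeriv ℝ n (cutoff (E := E3) ρ) x = 0 := by
  have hxt : x ∉ tsupport (cutoff (E := E3) ρ) := fun h => by
    have := tsupport_cutoff_subset hρ h
    rw [mem_closedBall, dist_zero_right] at this
    linarith
  exact image_eq_zero_of_notMem_tsupport fun h => hxt (tsupport_iteratedFDeriv_subset n h)

/-! ## 2. The annular cut-off `θ = (1 − χ_R)χ_{R′}` -/

/-- `θ` is smooth. [folklore] -/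
theorem contDiff_radialCutoff (R R' : ℝ) :
    ContDiff ℝ ∞ (fun x : E3 => (1 - cutoff R x) * cutoff R' x) :=
  (contDiff_const.sub (contDiff_cutoff R)).mul (contDiff_cutoff R')

/-- `θ` has compact support (`R′ > 0`). [folklore] -/
theorem hasCompactSupport_radialCutoff (R : ℝ) {R' : ℝ} (hR' : 0 < R') :
    HasCompactSupport (fun x : E3 => (1 - cutoff R x) * cutoff R' x) :=
  (hasCompactSupport_cutoff hR').mul_left

/-- `0 ≤ θ ≤ 1`. [folklore] -/
theorem radialCutoff_nonneg_le_one (R R' : ℝ) (x : E3) :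
    0 ≤ (1 - cutoff R x) * cutoff R' x ∧ (1 - cutoff R x) * cutoff R' x ≤ 1 := by
  have h1 := cutoff_nonneg R x; have h2 := cutoff_le_one R x
  have h3 := cutoff_nonneg R' x; have h4 := cutoff_le_one R' x
  exact ⟨mul_nonneg (by linarith) h3, mul_le_one₀ (by linarith) h3 h4⟩

/-- `θ = 1` on the annulus `{2R ≤ ‖x‖ ≤ R′}` (`R, R′ > 0`). [folklore] -/
theorem radialCutoff_eq_one {R R' : ℝ} (hR : 0 < R) (hR' : 0 < R') {x : E3} (h1 : 2 * R ≤ ‖x‖) (h2 : ‖x‖ ≤ R') :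
    (1 - cutoff R x) * cutoff R' x = 1 := by
  rw [cutoff_eq_zero hR h1, cutoff_eq_one hR' h2]; ring

/-- `θ = 0` on `B̄_R` (`R > 0`). [folklore] -/
theorem radialCutoff_eq_zero_of_le {R : ℝ} (hR : 0 < R) (R' : ℝ) {x : E3} (hx : ‖x‖ ≤ R) :
    (1 - cutoff R x) * cutoff R' x = 0 := by
  rw [cutoff_eq_one hR hx]; ring

/-- The support of `θ` lies in `{R ≤ ‖x‖}` (`R > 0`). [folklore] -/
theorem tsupport_radialCutoff_subset {R : ℝ} (hR : 0 < R) (R' : ℝ) :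
    tsupport (fun x : E3 => (1 - cutoff R x) * cutoff R' x) ⊆ {x : E3 | R ≤ ‖x‖} := by
  refine closure_minimal (fun x hx => ?_) (isClosed_le continuous_const continuous_norm)
  rw [mem_support] at hx
  by_contra h
  exact hx (radialCutoff_eq_zero_of_le hR R' (not_le.1 h).le)

/-! ## 3. The derivative weights -/

/-- **Uniform derivative weights of the annular cut-off.**  There is ONE constant `K` such that for all `1 ≤ R`, `4R ≤ R′` and all
`x`: `‖Dθ(x)‖ ≤ (K/R)·𝟙_{‖x‖≤2R} + (K/R′)·𝟙_{R′≤‖x‖}` and `‖D∇θ(x)‖ ≤ (K/R²)·𝟙_{‖x‖≤2R} + (K/R′²)·𝟙_{R′≤‖x‖}`. [folklore] -/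
theorem exists_radialCutoff_weights :
    ∃ K : ℝ, 0 < K ∧ ∀ R R' : ℝ, 1 ≤ R → 4 * R ≤ R' → ∀ x : E3,
      ‖fderiv ℝ (fun x : E3 => (1 - cutoff R x) * cutoff R' x) x‖ ≤
          K / R * (closedBall (0 : E3) (2 * R)).indicator (fun _ => (1 : ℝ)) x +
            K / R' * (ball (0 : E3) R')ᶜ.indicator (fun _ => (1 : ℝ)) x ∧
      ‖fderiv ℝ (gradient (fun x : E3 => (1 - cutoff R x) * cutoff R' x)) x‖ ≤
          K / R ^ 2 * (closedBall (0 : E3) (2 * R)).indicator (fun _ => (1 : ℝ)) x +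
            K / R' ^ 2 * (ball (0 : E3) R')ᶜ.indicator (fun _ => (1 : ℝ)) x := by
  obtain ⟨c, hc1, hc⟩ := exists_norm_iteratedFDeriv_cutoff_le
  have hc0 : 0 ≤ c := zero_le_one.trans hc1
  refine ⟨16 * c + 1, by positivity, fun R R' hR hRR' x => ?_⟩
  have hR0 : 0 < R := one_pos.trans_le hR
  have hR'1 : 1 ≤ R' := by linarith
  have hR'0 : 0 < R' := one_pos.trans_le hR'1
  set a : E3 → ℝ := cutoff R with hadef
  set b : E3 → ℝ := cutoff R' with hbdef
  set θ : E3 → ℝ := fun x : E3 => (1 - cutoff R x) * cutoff R' x with hθdef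
  have hθab : θ = b - fun x => a x * b x := by funext x; simp only [hθdef, hadef, hbdef, Pi.sub_apply]; ring
  have ha : ContDiff ℝ ∞ a := contDiff_cutoff R
  have hb : ContDiff ℝ ∞ b := contDiff_cutoff R'
  have ha2 : ContDiff ℝ 2 a := ha.of_le (by norm_cast)
  have hb2 : ContDiff ℝ 2 b := hb.of_le (by norm_cast)
  have hab2 : ContDiff ℝ 2 (fun x => a x * b x) := ha2.mul hb2
  -- the two norms in terms of `iteratedFDeriv`
  have hn1 : ‖fderiv ℝ θ x‖ = ‖iteratedFDeriv ℝ 1 θ x‖ := by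
    rw [← norm_iteratedFDeriv_fderiv, norm_iteratedFDeriv_zero]
  have hn2 : ‖fderiv ℝ (gradient θ) x‖ = ‖iteratedFDeriv ℝ 2 θ x‖ := by
    have hq : gradient θ = (InnerProductSpace.toDual ℝ E3).symm ∘ fderiv ℝ θ := rfl
    calc ‖fderiv ℝ (gradient θ) x‖ = ‖iteratedFDeriv ℝ 1 (gradient θ) x‖ := by
          rw [← norm_iteratedFDeriv_fderiv, norm_iteratedFDeriv_zero]
      _ = ‖iteratedFDeriv ℝ 2 θ x‖ := by
          rw [hq, (InnerProductSpace.toDual ℝ E3).symm.norm_iteratedFDeriv_comp_left, norm_iteratedFDeriv_fderiv]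
  -- the decomposition `Dⁿθ = Dⁿb − Dⁿ(ab)` and Leibniz for `ab`
  have hdec : ∀ n : ℕ, n ≤ 2 → ‖iteratedFDeriv ℝ n θ x‖ ≤ ‖iteratedFDeriv ℝ n b x‖ +
      ∑ i ∈ Finset.range (n + 1), (n.choose i : ℝ) * ‖iteratedFDeriv ℝ i a x‖ * ‖iteratedFDeriv ℝ (n - i) b x‖ := by
    intro n hn
    have hn' : (n : ℕ∞ω) ≤ 2 := by exact_mod_cast hn
    rw [hθab, iteratedFDeriv_sub_apply ((hb2.of_le hn').contDiffAt) ((hab2.of_le hn').contDiffAt)]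
    refine (norm_sub_le _ _).trans (add_le_add le_rfl ?_)
    exact norm_iteratedFDeriv_mul_le (f := a) (g := b) (n := n) ha2 hb2 x hn'
  -- vanishing facts
  have hb_in : ∀ n : ℕ, n ≠ 0 → ‖x‖ < R' → iteratedFDeriv ℝ n b x = 0 := fun n hn hx =>
    iteratedFDeriv_cutoff_eq_zero_of_lt hR'0 hx hn
  have ha_in : ∀ n : ℕ, n ≠ 0 → ‖x‖ < R → iteratedFDeriv ℝ n a x = 0 := fun n hn hx =>
    iteratedFDeriv_cutoff_eq_zero_of_lt hR0 hx hn
  have ha_out : ∀ n : ℕ, 2 * R < ‖x‖ → iteratedFDeriv ℝ n a x = 0 := fun n hx =>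
    iteratedFDeriv_cutoff_eq_zero_of_gt hR0 hx n
  have ha0 : ‖iteratedFDeriv ℝ 0 a x‖ ≤ 1 := by
    rw [norm_iteratedFDeriv_zero, Real.norm_of_nonneg (cutoff_nonneg R x)]; exact cutoff_le_one R x
  have hb0 : ‖iteratedFDeriv ℝ 0 b x‖ ≤ 1 := by
    rw [norm_iteratedFDeriv_zero, Real.norm_of_nonneg (cutoff_nonneg R' x)]; exact cutoff_le_one R' x
  have hae : ∀ i : ℕ, i ≤ 3 → ‖iteratedFDeriv ℝ i a x‖ ≤ c * ((1 + ‖x‖) ^ i)⁻¹ := fun i hi => hc R hR i hi x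
  have hbe : ∀ i : ℕ, i ≤ 3 → ‖iteratedFDeriv ℝ i b x‖ ≤ c * ((1 + ‖x‖) ^ i)⁻¹ := fun i hi => hc R' hR'1 i hi x
  -- expand the Leibniz sums for `n = 1, 2`
  have hL1 := hdec 1 (by norm_num)
  have hL2 := hdec 2 (by norm_num)
  rw [Finset.sum_range_succ, Finset.sum_range_succ, Finset.sum_range_zero] at hL1
  rw [Finset.sum_range_succ, Finset.sum_range_succ, Finset.sum_range_succ, Finset.sum_range_zero] at hL2
  simp only [Nat.choose_zero_right, Nat.choose_self, Nat.choose_one_right, Nat.cast_one, Nat.cast_ofNat, one_mul,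
    zero_add, Nat.sub_zero, Nat.reduceSub] at hL1 hL2
  rw [hn1, hn2]
  -- case analysis on `‖x‖`
  by_cases hx2R : ‖x‖ ≤ 2 * R
  · -- inner region: `b`-derivatives vanish, `b = ` anything in `[0,1]`
    have hxR' : ‖x‖ < R' := by linarith
    have hb1 : iteratedFDeriv ℝ 1 b x = 0 := hb_in 1 one_ne_zero hxR'
    have hb2' : iteratedFDeriv ℝ 2 b x = 0 := hb_in 2 two_ne_zero hxR'
    have hind1 : (closedBall (0 : E3) (2 * R)).indicator (fun _ => (1 : ℝ)) x = 1 :=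
      indicator_of_mem (mem_closedBall_zero_iff.2 hx2R) _
    have hind2 : 0 ≤ (ball (0 : E3) R')ᶜ.indicator (fun _ => (1 : ℝ)) x := indicator_nonneg (fun _ _ => zero_le_one) _
    simp only [hind1, mul_one]
    by_cases hxR : ‖x‖ < R
    · -- inside `B_R`: everything vanishes
      have ha1 : iteratedFDeriv ℝ 1 a x = 0 := ha_in 1 one_ne_zero hxR
      have ha2' : iteratedFDeriv ℝ 2 a x = 0 := ha_in 2 two_ne_zero hxR
      rw [hb1, ha1] at hL1
      rw [hb1, hb2', ha1, ha2'] at hL2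
      simp only [norm_zero, mul_zero, zero_mul, add_zero] at hL1 hL2
      constructor
      · exact hL1.trans (add_nonneg (div_nonneg (by positivity) hR0.le)
          (mul_nonneg (div_nonneg (by positivity) hR'0.le) hind2))
      · exact hL2.trans (add_nonneg (div_nonneg (by positivity) (sq_nonneg _))
          (mul_nonneg (div_nonneg (by positivity) (sq_nonneg _)) hind2))
    · -- transition `R ≤ ‖x‖ ≤ 2R`
      have hxR1 : R ≤ ‖x‖ := not_lt.1 hxR
      have hinv1 : ((1 + ‖x‖) ^ 1)⁻¹ ≤ 1 / R := by
        rw [pow_one, one_div]; exact inv_anti₀ hR0 (by linarith)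
      have hinv2 : ((1 + ‖x‖) ^ 2)⁻¹ ≤ 1 / R ^ 2 := by
        rw [one_div]; exact inv_anti₀ (by positivity) (by nlinarith)
      have ha1 : ‖iteratedFDeriv ℝ 1 a x‖ ≤ c * (1 / R) := (hae 1 (by norm_num)).trans (by gcongr)
      have ha2' : ‖iteratedFDeriv ℝ 2 a x‖ ≤ c * (1 / R ^ 2) := (hae 2 (by norm_num)).trans (by gcongr)
      rw [hb1] at hL1
      rw [hb1, hb2'] at hL2
      simp only [norm_zero, mul_zero, add_zero, zero_add] at hL1 hL2
      have hx1 : 0 ≤ (16 * c + 1) / R' * (ball (0 : E3) R')ᶜ.indicator (fun _ => (1 : ℝ)) x :=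
        mul_nonneg (div_nonneg (by positivity) hR'0.le) hind2
      have hx2 : 0 ≤ (16 * c + 1) / R' ^ 2 * (ball (0 : E3) R')ᶜ.indicator (fun _ => (1 : ℝ)) x :=
        mul_nonneg (div_nonneg (by positivity) (sq_nonneg _)) hind2
      constructor
      · calc ‖iteratedFDeriv ℝ 1 θ x‖ ≤ ‖iteratedFDeriv ℝ 1 a x‖ * ‖iteratedFDeriv ℝ 0 b x‖ := hL1
          _ ≤ c * (1 / R) * 1 := mul_le_mul ha1 hb0 (norm_nonneg _) (by positivity)
          _ ≤ (16 * c + 1) / R + (16 * c + 1) / R' * (ball (0 : E3) R')ᶜ.indicator (fun _ => (1 : ℝ)) x := by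
              have : c * (1 / R) * 1 ≤ (16 * c + 1) / R := by
                rw [mul_one, mul_one_div]; exact div_le_div_of_nonneg_right (by linarith) hR0.le
              linarith [this, hx1]
      · calc ‖iteratedFDeriv ℝ 2 θ x‖ ≤ ‖iteratedFDeriv ℝ 2 a x‖ * ‖iteratedFDeriv ℝ 0 b x‖ := hL2
          _ ≤ c * (1 / R ^ 2) * 1 := mul_le_mul ha2' hb0 (norm_nonneg _) (by positivity)
          _ ≤ (16 * c + 1) / R ^ 2 + (16 * c + 1) / R' ^ 2 * (ball (0 : E3) R')ᶜ.indicator (fun _ => (1 : ℝ)) x := by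
              have : c * (1 / R ^ 2) * 1 ≤ (16 * c + 1) / R ^ 2 := by
                rw [mul_one, mul_one_div]; exact div_le_div_of_nonneg_right (by linarith) (by positivity)
              linarith [this, hx2]
  · -- outer region `‖x‖ > 2R`: all `a`-derivatives vanish and `a x = 0`
    have hx2R' : 2 * R < ‖x‖ := not_le.1 hx2R
    have ha_all : ∀ n, iteratedFDeriv ℝ n a x = 0 := fun n => ha_out n hx2R'
    rw [ha_all 0, ha_all 1] at hL1
    rw [ha_all 0, ha_all 1, ha_all 2] at hL2
    simp only [norm_zero, zero_mul, mul_zero, add_zero] at hL1 hL2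
    have hind1 : 0 ≤ (closedBall (0 : E3) (2 * R)).indicator (fun _ => (1 : ℝ)) x := indicator_nonneg (fun _ _ => zero_le_one) _
    by_cases hxR' : ‖x‖ < R'
    · have hb1 : iteratedFDeriv ℝ 1 b x = 0 := hb_in 1 one_ne_zero hxR'
      have hb2' : iteratedFDeriv ℝ 2 b x = 0 := hb_in 2 two_ne_zero hxR'
      rw [hb1, norm_zero] at hL1
      rw [hb2', norm_zero] at hL2
      have hind2 : 0 ≤ (ball (0 : E3) R')ᶜ.indicator (fun _ => (1 : ℝ)) x := indicator_nonneg (fun _ _ => zero_le_one) _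
      constructor
      · exact hL1.trans (add_nonneg (mul_nonneg (div_nonneg (by positivity) hR0.le) hind1)
          (mul_nonneg (div_nonneg (by positivity) hR'0.le) hind2))
      · exact hL2.trans (add_nonneg (mul_nonneg (div_nonneg (by positivity) (sq_nonneg _)) hind1)
          (mul_nonneg (div_nonneg (by positivity) (sq_nonneg _)) hind2))
    · have hxR'1 : R' ≤ ‖x‖ := not_lt.1 hxR'
      have hind2 : (ball (0 : E3) R')ᶜ.indicator (fun _ => (1 : ℝ)) x = 1 :=
        indicator_of_mem (show x ∈ (ball (0 : E3) R')ᶜ by rw [mem_compl_iff, mem_ball_zero_iff]; exact hxR') _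
      simp only [hind2, mul_one]
      have hinv1 : ((1 + ‖x‖) ^ 1)⁻¹ ≤ 1 / R' := by
        rw [pow_one, one_div]; exact inv_anti₀ hR'0 (by linarith)
      have hinv2 : ((1 + ‖x‖) ^ 2)⁻¹ ≤ 1 / R' ^ 2 := by
        rw [one_div]; exact inv_anti₀ (by positivity) (by nlinarith)
      have hb1 : ‖iteratedFDeriv ℝ 1 b x‖ ≤ c * (1 / R') := (hbe 1 (by norm_num)).trans (by gcongr)
      have hb2' : ‖iteratedFDeriv ℝ 2 b x‖ ≤ c * (1 / R' ^ 2) := (hbe 2 (by norm_num)).trans (by gcongr)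
      have hx1 : 0 ≤ (16 * c + 1) / R * (closedBall (0 : E3) (2 * R)).indicator (fun _ => (1 : ℝ)) x :=
        mul_nonneg (div_nonneg (by positivity) hR0.le) hind1
      have hx2 : 0 ≤ (16 * c + 1) / R ^ 2 * (closedBall (0 : E3) (2 * R)).indicator (fun _ => (1 : ℝ)) x :=
        mul_nonneg (div_nonneg (by positivity) (sq_nonneg _)) hind1
      constructor
      · calc ‖iteratedFDeriv ℝ 1 θ x‖ ≤ c * (1 / R') := hL1.trans hb1
          _ ≤ (16 * c + 1) / R * (closedBall (0 : E3) (2 * R)).indicator (fun _ => (1 : ℝ)) x + (16 * c + 1) / R' := by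
              have : c * (1 / R') ≤ (16 * c + 1) / R' := by
                rw [mul_one_div]; exact div_le_div_of_nonneg_right (by linarith) hR'0.le
              linarith [this, hx1]
      · calc ‖iteratedFDeriv ℝ 2 θ x‖ ≤ c * (1 / R' ^ 2) := hL2.trans hb2'
          _ ≤ (16 * c + 1) / R ^ 2 * (closedBall (0 : E3) (2 * R)).indicator (fun _ => (1 : ℝ)) x + (16 * c + 1) / R' ^ 2 := by
              have : c * (1 / R' ^ 2) ≤ (16 * c + 1) / R' ^ 2 := by
                rw [mul_one_div]; exact div_le_div_of_nonneg_right (by linarith) (by positivity)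
              linarith [this, hx2]

end ExtremiserLiouville

end Summit.NavierStokesRegularity.NavierStokesRegularity.Theorems

end
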